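import Summits.BirchSwinnertonDyer.BirchSwinnertonDyer.Theorems.SignedLowerHalvesSharpFlatCharValueRankZeroAllLevelsOfGreenberg
import Summits.BirchSwinnertonDyer.BirchSwinnertonDyer.Theorems.ByReductionTypeAtTwoSupersingularFlatCountTwoOfShaTwo
import Summits.BirchSwinnertonDyer.BirchSwinnertonDyer.Theorems.ThetaPartnerAtTwoSignedControlAtTwoShaTwoPrimaryVanishingOdd
import Summits.BirchSwinnertonDyer.BirchSwinnertonDyer.Theorems.ThetaPartnerAtTwoSignedControlAtTwoCasselsOfPT
import HarnessLib

/-!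
# Sprung 2024 §5.2 (Lemmas 5.5 · 5.8 · 5.9, all conductors, BOTH colours) and the route input
# `SignedLowerHalves.SharpFlatCharValueRankZeroAllLevels` (= `Sprung2024.lem59AllN` = `PrintX8VS.InputLem59AllN`,
# item stmt-BirchSwinnertonDyer-19878) FROM TWO GENERIC POITOU–TATE ROWS OVER `ℚ` BY NAME —
# Greenberg's Prop. 4.12 and §5 p. 140 (= Kato Thm. 12.4, weak Leopoldt) LEAVE the base of rows 7/8,
# and at an ODD prime no archimedean Poitou–Tate row enters

Cell `bsd-inputs` (D-0154 (2) INPUTS→UNCONDITIONAL), tranche T1 of `INPUTS-LIST-2-ADDENDUM-4/5`; seat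
`bsd-inputs-l55-p1` (gen 2), landing the plan-2 sketch IMPROVED at odd `p`. Sequel of
`…SharpFlatCharValueRankZeroAllLevelsOfGreenberg.lean` (same seat, gen 0: the same conclusions ⟸ {Prop. 4.13 (Cassels),
Prop. 4.12, §5 p. 140}) using the K4-inputs seat's any-prime door
`SSFlatEC.sharpFlatEndCoinvariants_subsingleton_of_cassels_of_shaTwo` (`(Sel^•(E/ℚ_∞))_γ = 0` ⟸ CASSELS + `Sel` finite +
`#E(ℚ)[p^∞] = 1` + `Ш²(ℚ, E[p^∞]) = ⊥` + the `•`-local lift above `p`): at an ODD supersingular prime the `•`-local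
lift is the Honda-system theorem `hlocp_of_isHondaSystem` (its `unramifiedOutside` binder fed by AEU,
`SignedEC.ResTwo.exists_finset_mem_unramifiedOutside`), `#E(ℚ)[p^∞] = 1` is
`natCard_fixedPoints_geomPrimaryTorsion_eq_one_of_supersingular`, and — the point of this gen-2 version —
`Ш²(ℚ, E[p^∞]) = ⊥` is the K4-inputs seat's ODD-PRIME vanishing
`SignedEC.PrimaryTorsionH2.forall_mem_shaTwo_primary_eq_zero_of_ne_two` (every number field, `p ≠ 2`: `cd_p(Γ_K) ≤ 2`
is the tree theorem `fieldCdLE_two_of_numberField_holds`, and `H²(K_w, ·)` at an infinite place is killed by `2` and by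
the odd level), which needs the ONE generic row `poitouTate_sha_tateDual ℚ` (Milne ADT I Thm. 4.10 (a)) and NO
archimedean row (`poitouTate_three_realPlaces_injective`, `poitouTate_two_realPlaces_surjective` are NOT used, unlike
the `p = 2` door `SSFlatEC.flatCountTwo_of_cassels_of_poitouTate`). CASSELS (`Greenberg1999.casselsSurjectivity_H1Sigma ℚ`,
Prop. 4.13) is either kept by name (`…_of_cassels_of_poitouTate`) or discharged to the second generic row
`poitouTate_selmerStructure_duality ℚ` by `SignedEC.CasselsPT.casselsSurjectivity_H1Sigma_of_poitouTate` (`…_of_poitouTate`).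

* `hlocp_top_of_isHondaSystem` — LOC⋆ above `p` for a genuine Honda system, odd `p`, either colour, in the binder
  shape of the any-prime door (no `unramifiedOutside` restriction);
* `sharpFlatCount_of_cassels_of_shaTwo` — Lemma 5.5 (all `N`) at `(W, p, ⋆)` ⟸ CASSELS + `Ш²(ℚ, E[p^∞]) = ⊥`;
* `shaTwo_primary_eq_bot_of_supersingular_of_poitouTate` — `Ш²(ℚ, E[p^∞]) = ⊥` at an odd supersingular prime with
  `Sel` finite ⟸ `poitouTate_sha_tateDual ℚ` ALONE;
* `sharpFlatCount_of_cassels_of_poitouTate` / `sharpFlatCount_of_poitouTate` — Lemma 5.5 ⟸ CASSELS (resp. PT-Sel) +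
  PT-Ш;
* `lem55AllN_of_cassels_of_poitouTate`, `lem55AllN_of_poitouTate`, `lem59AllN_of_cassels_of_poitouTate`,
  `lem59AllN_of_poitouTate`, `lem59_of_cassels_of_poitouTate`, `lem59_of_poitouTate` — the named facts of
  Sprung 2024 §5.2;
* BY NAME: `sharpFlatCharValueRankZeroAllLevels_of_cassels_of_poitouTate : CASSELS → PT-Ш → …` and
  `sharpFlatCharValueRankZeroAllLevels_of_poitouTate : PT-Sel → PT-Ш → SignedLowerHalves.SharpFlatCharValueRankZeroAllLevels`
  (serves `PrintX8VS.InputLem59AllN` / `PrintX8.InputLem59AllN` verbatim, same body).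

NET EFFECT ON THE INPUT LEDGER (D-0154 (2)): under item 19878 (rows 7/8 + SLH) the displayed base
{Prop. 4.13, Prop. 4.12, §5 p. 140 = Kato 12.4} of `lem59AllN_of_greenberg` may be replaced by
{Prop. 4.13 (or PT-Sel), PT-Ш} — TWO generic class-field-theory duality statements over `ℚ`
(Milne ADT I Thm. 4.10 (a) for finite modules; Thm. 4.10 for Selmer structures / Howard 2.1.11), a SUBSET of the
row-1 / K4 base at `p = 2` (which also carries the two archimedean rows).
HONEST FRAMING: theorems only; CONDITIONAL on those named facts (hypotheses); item 19878 is NOT closed (no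
unconditional `_holds`); the `_of_greenberg` theorems stay (different base); no summit statement is proved; no census
cell moves; BSD is not proved by any of this.

References: [Sprung2024] §5.2 Lemmas 5.5–5.9 and Proof of Thm. 5.3 (pp. 39–41); [RaySprung2025] p. 2343;
[GreenbergLNM1716] §3 Lemma 3.3, §4 pp. 104–108 (Lemma 4.7), Prop. 4.13 / p. 122; [MilneADT2006] I Thm. 4.10, Lemma 6.12,
Thm. 6.13 (c); [SerreGaloisCohomology1997] II §4.4 Prop. 13; [Sprung2012] Thm. 2.2, Lemma 2.3, Props. 7.3/7.6;
[Cassels1964ArithmeticVII].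
-/

set_option autoImplicit false
-- the Theorems namespace of this sub repeats the summit name by design (D-0017 nested layout)
set_option linter.dupNamespace false

noncomputable section

open scoped Classical NumberField

open NumberField IsDedekindDomain

namespace Summit.BirchSwinnertonDyer.BirchSwinnertonDyer.Theorems.SharpFlatCount

open Literature.NumberTheory.EllipticCurves Literature.NumberTheory.GaloisRepresentations
  WeierstrassCurve ZpExtension Literature.NumberTheory.EllipticCurves.Kobayashi2003
  Literature.NumberTheory.EllipticCurves.Sprung2017 Literature.NumberTheory.EllipticCurves.Sprung2012
  Literature.NumberTheory.EllipticCurves.Sprung2024 Literature.NumberTheory.EllipticCurves.IwasawaDual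
  Literature.NumberTheory.EllipticCurves.IwasawaAlgebra Literature.NumberTheory.EllipticCurves.GreenbergVatsal2000
  Literature.NumberTheory.EllipticCurves.Rank1Residual Summit.BirchSwinnertonDyer.Rank1Residual.X5.O1
  Summit.BirchSwinnertonDyer.Rank1Residual.X2
  Summit.BirchSwinnertonDyer.BirchSwinnertonDyer.Theorems.SSFlatEC
  Literature.NumberTheory.GaloisCohomology
open Summit.BirchSwinnertonDyer.Rank1Residual.X11b (LocBridge.primaryGaloisModule)
open Literature.NumberTheory.GaloisRepresentations.DiscreteGaloisModule (shaTwo)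

variable (W : WeierstrassCurve ℚ) [W.IsElliptic] [W.IsGloballyMinimal] (p : ℕ) [Fact p.Prime]

/-! ## §1 LOC⋆ above `p` in the binder shape of the any-prime door -/

/-- **LOC⋆ at the place above `p` for a genuine Honda system, odd `p`, EITHER colour, for EVERY class `t` of
`H¹(ℚ_∞, E[p^∞])`** (the `hlocp` binder of `SSFlatEC.sharpFlatEndCoinvariants_subsingleton_of_cassels_of_shaTwo`):
`hlocp_of_isHondaSystem` with its (unused) `unramifiedOutside` binder fed by AEU
(`SignedEC.ResTwo.exists_finset_mem_unramifiedOutside`). [cite: GreenbergLNM1716, §3 Lemma 3.3 (p. 87), §4 p. 108]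
[cite: Sprung2012, Def. 7.9, Lemma 7.10, Lemma 2.3, Thm. 2.2] -/
theorem hlocp_top_of_isHondaSystem (hp2 : p ≠ 2) (hgoodp : W.HasGoodReductionAtPrime p)
    (hap : (p : ℤ) ∣ W.frobeniusTrace p) (κ : ZpExtension ℚ p) (hκ : κ.IsCyclotomic)
    {v : HeightOneSpectrum (𝓞 ℚ)} (hv : (p : 𝓞 ℚ) ∈ v.asIdeal)
    {g : Field.absoluteGaloisGroup (v.adicCompletion ℚ)}
    (hg : κ.IsTopGenerator (resGalOfEmb (closureEmb (K := ℚ) (v.adicCompletion ℚ)) g))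
    {cneg : localPoints W (v.adicCompletion ℚ)} {c : ℕ → localPoints W (v.adicCompletion ℚ)}
    (hH : IsHondaSystem κ (closureEmb (K := ℚ) (v.adicCompletion ℚ)) W (W.frobeniusTrace p) g cneg c)
    (col : Chroma) :
    ∀ t : W.subgroupH1 p κ.kerSubgroup,
      (∀ σ : Field.absoluteGaloisGroup ℚ, W.conjH1 p κ.kerSubgroup σ t - t ∈
        sharpFlatSelmerInfty W κ (closureEmb (K := ℚ) (v.adicCompletion ℚ)) (W.frobeniusTrace p) g c col) →
      ∀ w : HeightOneSpectrum (𝓞 ℚ), ((p : ℕ) : 𝓞 ℚ) ∈ w.asIdeal →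
      ∃ xw : discreteH1 (localSubgroup (⊤ : Subgroup (Field.absoluteGaloisGroup ℚ)) (w.adicCompletion ℚ))
          (localPoints W (w.adicCompletion ℚ)),
        (∃ k : ℕ, p ^ k • xw = 0) ∧
        ∀ y : W.subgroupH1 p (⊤ : Subgroup (Field.absoluteGaloisGroup ℚ)),
          W.localResOver p ⊤ (w.adicCompletion ℚ) y = xw →
          t - W.resOfLe p (le_top : κ.kerSubgroup ≤ ⊤) y ∈
              W.localKerOver p κ.kerSubgroup (w.adicCompletion ℚ) ∧
          (w = v → t - W.resOfLe p (le_top : κ.kerSubgroup ≤ ⊤) y ∈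
            sharpFlatLocalKummerOverOfEmb W p κ.kerSubgroup (closureEmb (K := ℚ) (v.adicCompletion ℚ))
              (localTowerPointsOfEmb κ (closureEmb (K := ℚ) (v.adicCompletion ℚ)) W)
              (colemanKer κ (closureEmb (K := ℚ) (v.adicCompletion ℚ)) W (W.frobeniusTrace p) g c col)) := by
  intro t hconj w hw
  -- AEU: `t` is unramified outside some finite `S₀`; the Honda-system lift ignores which
  obtain ⟨S₀, -, htH⟩ := SignedEC.ResTwo.exists_finset_mem_unramifiedOutside W p κ.kerSubgroup t
  exact hlocp_of_isHondaSystem W p hp2 hgoodp hap κ hκ hv hg hH col S₀ t htH hconj w hw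

/-! ## §2 Lemma 5.5 (all `N`), both colours, from CASSELS and `Ш²(ℚ, E[p^∞]) = ⊥` -/

/-- **Sprung 2024 Lemma 5.5 (all `N`) at `(W, p, ⋆)`, `p` odd supersingular, EITHER colour — from CASSELS by name
and `Ш²(ℚ, E[p^∞]) = ⊥` (under `Sel_{p^∞}(E/ℚ)` finite), NOTHING ELSE displayed**: `#E(ℚ)[p^∞] = 1`
(`natCard_fixedPoints_geomPrimaryTorsion_eq_one_of_supersingular`), `#ker g⋆ = p^{ord_p ∏ c_ℓ}` (Cassels' count
`natCard_flatKerG_eq_pow_of_casselsSurjectivity` with the kdot clauses «`Ker Col⋆` kills `E(ℚ_p)`», «`r_p` injective»),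
`(Sel⋆_∞)_γ = 0` (`SSFlatEC.sharpFlatEndCoinvariants_subsingleton_of_cassels_of_shaTwo` with §1). NO Prop. 4.12, NO
dual datum, NO rank / corank / weak-Leopoldt input, no `Σ₀`.
[cite: Sprung2024, §5.2 Lemma 5.5 (p. 40)] [cite: GreenbergLNM1716, §4 Lemma 4.7 (pp. 107–108), Prop. 4.13 / p. 122] -/
theorem sharpFlatCount_of_cassels_of_shaTwo (hp2 : p ≠ 2) (hgoodp : W.HasGoodReductionAtPrime p)
    (hap : (p : ℤ) ∣ W.frobeniusTrace p) (κ : ZpExtension ℚ p) (hκ : κ.IsCyclotomic)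
    {γ : Field.absoluteGaloisGroup ℚ} (hγ : κ.IsTopGenerator γ)
    {v : HeightOneSpectrum (𝓞 ℚ)} (hv : (p : 𝓞 ℚ) ∈ v.asIdeal)
    {g : Field.absoluteGaloisGroup (v.adicCompletion ℚ)}
    (hg : κ.IsTopGenerator (resGalOfEmb (closureEmb (K := ℚ) (v.adicCompletion ℚ)) g))
    {cneg : localPoints W (v.adicCompletion ℚ)} {c : ℕ → localPoints W (v.adicCompletion ℚ)}
    (hH : IsHondaSystem κ (closureEmb (K := ℚ) (v.adicCompletion ℚ)) W (W.frobeniusTrace p) g cneg c)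
    (col : Chroma)
    (hC : Greenberg1999.casselsSurjectivity_H1Sigma ℚ)
    (hsha : Finite (W.selmerGroupPInfty p) → shaTwo (LocBridge.primaryGaloisModule W p) = ⊥) :
    Finite (W.selmerGroupPInfty p) →
      Finite (EndCoinvariants (conjSharpFlatSelmerInfty W κ (closureEmb (K := ℚ) (v.adicCompletion ℚ))
        (W.frobeniusTrace p) g c col γ - 1)) →
      Nat.card (↥((sharpFlatSelmerInfty W κ (closureEmb (K := ℚ) (v.adicCompletion ℚ))
            (W.frobeniusTrace p) g c col).comap (W.layerToInfty κ 0)) ⧸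
          (W.selmerLayer κ 0).addSubgroupOf
            ((sharpFlatSelmerInfty W κ (closureEmb (K := ℚ) (v.adicCompletion ℚ))
              (W.frobeniusTrace p) g c col).comap (W.layerToInfty κ 0))) *
        Nat.card (MulAction.fixedPoints (Field.absoluteGaloisGroup ℚ) (W.geomPrimaryTorsion p)) =
      p ^ (padicValNat p W.tamagawaProduct) *
        Nat.card (EndCoinvariants (conjSharpFlatSelmerInfty W κ
          (closureEmb (K := ℚ) (v.adicCompletion ℚ)) (W.frobeniusTrace p) g c col γ - 1)) := by
  have hv' : ((p : ℕ) : 𝓞 ℚ) ∈ v.asIdeal := by exact_mod_cast hv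
  -- `#E(ℚ)[p^∞] = 1` at an odd supersingular prime
  have htors : Nat.card (MulAction.fixedPoints (Field.absoluteGaloisGroup ℚ) (W.geomPrimaryTorsion p)) = 1 :=
    natCard_fixedPoints_geomPrimaryTorsion_eq_one_of_supersingular W p hp2 hgoodp hap
  -- good reduction at the place `v ∋ p`
  have hgoodv : W.HasGoodReductionAt v :=
    (hasGoodReductionAtPrime_primesEquiv_iff_holds W v p
      (Literature.NumberTheory.GaloisRepresentations.LocalField.primesEquiv_eq_of_natCast_mem p v hv')).mp hgoodp
  -- «`Ker Col⋆` kills `E(ℚ_p)`» and «`r_p` injective» (kdot theorems, both colours, odd `p`)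
  have h𝒦 : ∀ z ∈ colemanKer κ (closureEmb (K := ℚ) (v.adicCompletion ℚ)) W (W.frobeniusTrace p) g c col,
      ∀ (x : localPoints W (v.adicCompletion ℚ))
        (hx : x ∈ localLayerPointsOfEmb κ (closureEmb (K := ℚ) (v.adicCompletion ℚ)) W 0),
        z ⟨x, localLayerPointsOfEmb_le_localTowerPointsOfEmb κ _ W 0 hx⟩ = 0 := fun z hz x hx ↦
    colemanKer_apply_eq_zero_of_mem_localLayerPointsOfEmb_zero κ _ W hp2 hap hg hH col hz hx
  have hrp := lem55AllN_sharpFlat_localKerOver_of_layerToInfty_mem_holds W p hp2 hgoodp hap κ hκ v hv g hg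
    cneg c hH col
  refine sharpFlatCount_of_cassels_of_coinv W p κ γ g c col htors (fun hSel ↦ ?_) (fun hSel _ ↦ ?_)
  · -- Cassels' count, by name
    exact natCard_flatKerG_eq_pow_of_casselsSurjectivity W κ (W.frobeniusTrace p) g c col hC hκ hv' hgoodv
      h𝒦 hrp hSel htors
  · -- COINV⋆ from CASSELS + `Ш² = ⊥` + LOC⋆ above `p` (any-prime door of the K4-inputs seat, §1)
    haveI := sharpFlatEndCoinvariants_subsingleton_of_cassels_of_shaTwo W κ (W.frobeniusTrace p) g c col hκ hγ
      hv' hC hSel htors (hsha hSel) (hlocp_top_of_isHondaSystem W p hp2 hgoodp hap κ hκ hv hg hH col)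
    exact Nat.card_unique

/-! ## §3 `Ш²(ℚ, E[p^∞]) = ⊥` at an odd prime, discharged to ONE generic Poitou–Tate row over `ℚ` -/

/-- **`Ш²(ℚ, E[p^∞]) = ⊥` at an odd supersingular prime with `Sel_{p^∞}(E/ℚ)` finite, modulo
`poitouTate_sha_tateDual ℚ` ALONE** (no archimedean row: `p ≠ 2`): the K4-inputs seat's
`SignedEC.PrimaryTorsionH2.forall_mem_shaTwo_primary_eq_zero_of_ne_two` (finite + `p`-primary + `p`-divisible, the
divisibility from `cd_p(Γ_ℚ) ≤ 2` and `H²(ℝ, E[p^{M+1}]) = 0`), with `E[p^∞]^{Γ_ℚ} = 0` from `#E[p^∞]^{Γ_ℚ} = 1`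
(`natCard_fixedPoints_geomPrimaryTorsion_eq_one_of_supersingular`).
[cite: MilneADT2006, Ch. I, Thm. 4.10 (a), Lemma 6.12, Thm. 6.13 (c)] [cite: SerreGaloisCohomology1997, II §4.4 Prop. 13] -/
theorem shaTwo_primary_eq_bot_of_supersingular_of_poitouTate (hp2 : p ≠ 2)
    (hgoodp : W.HasGoodReductionAtPrime p) (hap : (p : ℤ) ∣ W.frobeniusTrace p)
    (hPT : poitouTate_sha_tateDual ℚ) (hSel : Finite (W.selmerGroupPInfty p)) :
    shaTwo (LocBridge.primaryGaloisModule W p) = ⊥ := by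
  haveI := hSel
  have htors : Nat.card (MulAction.fixedPoints (Field.absoluteGaloisGroup ℚ) (W.geomPrimaryTorsion p)) = 1 :=
    natCard_fixedPoints_geomPrimaryTorsion_eq_one_of_supersingular W p hp2 hgoodp hap
  rw [eq_bot_iff]
  intro z hz
  rw [AddSubgroup.mem_bot]
  exact SignedEC.PrimaryTorsionH2.forall_mem_shaTwo_primary_eq_zero_of_ne_two W p hp2 hPT
    (fun Q hQ ↦ SignedEC.CasselsPT.forall_fixed_eq_zero_of_natCard_fixedPoints_eq_one W p htors Q fun σ ↦ hQ σ)
    z hz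

/-- **Lemma 5.5 (all `N`) at `(W, p, ⋆)` ⟸ CASSELS by name + the ONE generic row `poitouTate_sha_tateDual ℚ`.**
[cite: Sprung2024, §5.2 Lemma 5.5 (p. 40)] [cite: GreenbergLNM1716, §4 Lemma 4.7, Prop. 4.13 / p. 122]
[cite: MilneADT2006, Ch. I, Thm. 4.10 (a), Thm. 6.13 (c)] -/
theorem sharpFlatCount_of_cassels_of_poitouTate (hp2 : p ≠ 2) (hgoodp : W.HasGoodReductionAtPrime p)
    (hap : (p : ℤ) ∣ W.frobeniusTrace p) (κ : ZpExtension ℚ p) (hκ : κ.IsCyclotomic)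
    {γ : Field.absoluteGaloisGroup ℚ} (hγ : κ.IsTopGenerator γ)
    {v : HeightOneSpectrum (𝓞 ℚ)} (hv : (p : 𝓞 ℚ) ∈ v.asIdeal)
    {g : Field.absoluteGaloisGroup (v.adicCompletion ℚ)}
    (hg : κ.IsTopGenerator (resGalOfEmb (closureEmb (K := ℚ) (v.adicCompletion ℚ)) g))
    {cneg : localPoints W (v.adicCompletion ℚ)} {c : ℕ → localPoints W (v.adicCompletion ℚ)}
    (hH : IsHondaSystem κ (closureEmb (K := ℚ) (v.adicCompletion ℚ)) W (W.frobeniusTrace p) g cneg c)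
    (col : Chroma)
    (hC : Greenberg1999.casselsSurjectivity_H1Sigma ℚ) (hPT : poitouTate_sha_tateDual ℚ) :
    Finite (W.selmerGroupPInfty p) →
      Finite (EndCoinvariants (conjSharpFlatSelmerInfty W κ (closureEmb (K := ℚ) (v.adicCompletion ℚ))
        (W.frobeniusTrace p) g c col γ - 1)) →
      Nat.card (↥((sharpFlatSelmerInfty W κ (closureEmb (K := ℚ) (v.adicCompletion ℚ))
            (W.frobeniusTrace p) g c col).comap (W.layerToInfty κ 0)) ⧸
          (W.selmerLayer κ 0).addSubgroupOf
            ((sharpFlatSelmerInfty W κ (closureEmb (K := ℚ) (v.adicCompletion ℚ))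
              (W.frobeniusTrace p) g c col).comap (W.layerToInfty κ 0))) *
        Nat.card (MulAction.fixedPoints (Field.absoluteGaloisGroup ℚ) (W.geomPrimaryTorsion p)) =
      p ^ (padicValNat p W.tamagawaProduct) *
        Nat.card (EndCoinvariants (conjSharpFlatSelmerInfty W κ
          (closureEmb (K := ℚ) (v.adicCompletion ℚ)) (W.frobeniusTrace p) g c col γ - 1)) :=
  sharpFlatCount_of_cassels_of_shaTwo W p hp2 hgoodp hap κ hκ hγ hv hg hH col hC
    (shaTwo_primary_eq_bot_of_supersingular_of_poitouTate W p hp2 hgoodp hap hPT)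

/-- **Lemma 5.5 (all `N`) at `(W, p, ⋆)` ⟸ the TWO generic Poitou–Tate rows over `ℚ`** (CASSELS discharged to
`poitouTate_selmerStructure_duality ℚ` by `SignedEC.CasselsPT.casselsSurjectivity_H1Sigma_of_poitouTate`).
[cite: Sprung2024, §5.2 Lemma 5.5 (p. 40)] [cite: GreenbergLNM1716, §4 Prop. 4.13 / p. 122]
[cite: MilneADT2006, Ch. I, Thm. 4.10, Thm. 6.13, Lemma 6.15] [cite: Cassels1964ArithmeticVII, Thm.] -/
theorem sharpFlatCount_of_poitouTate (hp2 : p ≠ 2) (hgoodp : W.HasGoodReductionAtPrime p)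
    (hap : (p : ℤ) ∣ W.frobeniusTrace p) (κ : ZpExtension ℚ p) (hκ : κ.IsCyclotomic)
    {γ : Field.absoluteGaloisGroup ℚ} (hγ : κ.IsTopGenerator γ)
    {v : HeightOneSpectrum (𝓞 ℚ)} (hv : (p : 𝓞 ℚ) ∈ v.asIdeal)
    {g : Field.absoluteGaloisGroup (v.adicCompletion ℚ)}
    (hg : κ.IsTopGenerator (resGalOfEmb (closureEmb (K := ℚ) (v.adicCompletion ℚ)) g))
    {cneg : localPoints W (v.adicCompletion ℚ)} {c : ℕ → localPoints W (v.adicCompletion ℚ)}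
    (hH : IsHondaSystem κ (closureEmb (K := ℚ) (v.adicCompletion ℚ)) W (W.frobeniusTrace p) g cneg c)
    (col : Chroma)
    (hPTs : poitouTate_selmerStructure_duality ℚ) (hPT : poitouTate_sha_tateDual ℚ) :
    Finite (W.selmerGroupPInfty p) →
      Finite (EndCoinvariants (conjSharpFlatSelmerInfty W κ (closureEmb (K := ℚ) (v.adicCompletion ℚ))
        (W.frobeniusTrace p) g c col γ - 1)) →
      Nat.card (↥((sharpFlatSelmerInfty W κ (closureEmb (K := ℚ) (v.adicCompletion ℚ))
            (W.frobeniusTrace p) g c col).comap (W.layerToInfty κ 0)) ⧸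
          (W.selmerLayer κ 0).addSubgroupOf
            ((sharpFlatSelmerInfty W κ (closureEmb (K := ℚ) (v.adicCompletion ℚ))
              (W.frobeniusTrace p) g c col).comap (W.layerToInfty κ 0))) *
        Nat.card (MulAction.fixedPoints (Field.absoluteGaloisGroup ℚ) (W.geomPrimaryTorsion p)) =
      p ^ (padicValNat p W.tamagawaProduct) *
        Nat.card (EndCoinvariants (conjSharpFlatSelmerInfty W κ
          (closureEmb (K := ℚ) (v.adicCompletion ℚ)) (W.frobeniusTrace p) g c col γ - 1)) :=
  sharpFlatCount_of_cassels_of_poitouTate W p hp2 hgoodp hap κ hκ hγ hv hg hH col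
    (SignedEC.CasselsPT.casselsSurjectivity_H1Sigma_of_poitouTate hPTs) hPT

/-! ## §4 The named facts of Sprung 2024 §5.2 and the route decl BY NAME -/

/-- **`Sprung2024.lem55AllN_sharpFlat_coinvariants_card` ⟸ CASSELS (Greenberg Prop. 4.13) + the ONE generic row
`poitouTate_sha_tateDual ℚ`, by name.** The hypotheses `L(E,1) ≠ 0` and `IsCyclotomicVariable` of the named fact are
not used. [cite: Sprung2024, §5.2 Lemma 5.5 (p. 40)] [cite: RaySprung2025, p. 2343]
[cite: GreenbergLNM1716, §4 Lemma 4.7 (pp. 107–108), Prop. 4.13 / p. 122] [cite: MilneADT2006, Ch. I, Thm. 4.10 (a)] -/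
theorem lem55AllN_of_cassels_of_poitouTate (hC : Greenberg1999.casselsSurjectivity_H1Sigma ℚ)
    (hPT : poitouTate_sha_tateDual ℚ) :
    Sprung2024.lem55AllN_sharpFlat_coinvariants_card := by
  intro W _ _ p _ hp2 hgoodp hap _hL κ γ hκ hγ _hX v hv g hg cneg c hH col hSel hco
  exact sharpFlatCount_of_cassels_of_poitouTate W p hp2 hgoodp hap κ hκ hγ hv hg hH col hC hPT hSel hco

/-- **`Sprung2024.lem55AllN_sharpFlat_coinvariants_card` ⟸ the TWO generic Poitou–Tate rows over `ℚ`** (CASSELS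
discharged to `poitouTate_selmerStructure_duality ℚ` by `SignedEC.CasselsPT.casselsSurjectivity_H1Sigma_of_poitouTate`).
[cite: Sprung2024, §5.2 Lemma 5.5 (p. 40)] [cite: GreenbergLNM1716, §4 Prop. 4.13 / p. 122]
[cite: MilneADT2006, Ch. I, Thm. 4.10, Thm. 6.13, Lemma 6.15] [cite: Cassels1964ArithmeticVII, Thm.] -/
theorem lem55AllN_of_poitouTate (hPTs : poitouTate_selmerStructure_duality ℚ)
    (hPT : poitouTate_sha_tateDual ℚ) :
    Sprung2024.lem55AllN_sharpFlat_coinvariants_card := by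
  intro W _ _ p _ hp2 hgoodp hap _hL κ γ hκ hγ _hX v hv g hg cneg c hH col hSel hco
  exact sharpFlatCount_of_poitouTate W p hp2 hgoodp hap κ hκ hγ hv hg hH col hPTs hPT hSel hco

/-- **`Sprung2024.lem59AllN_sharpFlatCharValue_rankZero` (the item's signature) ⟸ CASSELS + the ONE row
`poitouTate_sha_tateDual ℚ`**: Lemma 5.5 from §4, Lemmas 5.8/5.9 and the `v = p` clause are kernel theorems
(`lem59AllN_of_lem55AllNcard_of_prop73_prop76` with `prop73/76_…_holds`).
[cite: Sprung2024, §5.2 Lemmas 5.5, 5.8, 5.9 and Proof of Thm. 5.3 (pp. 40–41)] [cite: RaySprung2025, p. 2343]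
[cite: GreenbergLNM1716, §4 Prop. 4.13 / p. 122] [cite: Sprung2012, Prop. 7.3 (p. 1500), Prop. 7.6 (p. 1501)] -/
theorem lem59AllN_of_cassels_of_poitouTate (hC : Greenberg1999.casselsSurjectivity_H1Sigma ℚ)
    (hPT : poitouTate_sha_tateDual ℚ) :
    Sprung2024.lem59AllN_sharpFlatCharValue_rankZero :=
  lem59AllN_of_lem55AllNcard_of_prop73_prop76 (lem55AllN_of_cassels_of_poitouTate hC hPT)
    prop73_colemanFlat_surjective_holds prop76_colemanSharp_surjective_holds

/-- **`Sprung2024.lem59AllN_sharpFlatCharValue_rankZero` ⟸ the TWO generic Poitou–Tate rows over `ℚ`.**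
[cite: Sprung2024, §5.2 (pp. 39–41)] [cite: MilneADT2006, Ch. I, Thm. 4.10] -/
theorem lem59AllN_of_poitouTate (hPTs : poitouTate_selmerStructure_duality ℚ)
    (hPT : poitouTate_sha_tateDual ℚ) :
    Sprung2024.lem59AllN_sharpFlatCharValue_rankZero :=
  lem59AllN_of_lem55AllNcard_of_prop73_prop76 (lem55AllN_of_poitouTate hPTs hPT)
    prop73_colemanFlat_surjective_holds prop76_colemanSharp_surjective_holds

/-- **Sprung 2024 §5.2 as printed (square-free conductor; `Sprung2024.lem59_sharpFlatCharValue_rankZero`) ⟸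
CASSELS + the ONE row `poitouTate_sha_tateDual ℚ`.** [cite: Sprung2024, §5.2 Proof of Thm. 5.3 (p. 41)]
[cite: GreenbergLNM1716, §4 Prop. 4.13 / p. 122] [cite: MilneADT2006, Ch. I, Thm. 4.10 (a)] -/
theorem lem59_of_cassels_of_poitouTate (hC : Greenberg1999.casselsSurjectivity_H1Sigma ℚ)
    (hPT : poitouTate_sha_tateDual ℚ) :
    Sprung2024.lem59_sharpFlatCharValue_rankZero :=
  lem59_of_lem55AllNcard_of_prop73_prop76 (lem55AllN_of_cassels_of_poitouTate hC hPT)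
    prop73_colemanFlat_surjective_holds prop76_colemanSharp_surjective_holds

/-- **Sprung 2024 §5.2 as printed (square-free conductor; `Sprung2024.lem59_sharpFlatCharValue_rankZero`) ⟸ the
TWO Poitou–Tate rows.** [cite: Sprung2024, §5.2 Proof of Thm. 5.3 (p. 41)] [cite: MilneADT2006, Ch. I, Thm. 4.10] -/
theorem lem59_of_poitouTate (hPTs : poitouTate_selmerStructure_duality ℚ)
    (hPT : poitouTate_sha_tateDual ℚ) :
    Sprung2024.lem59_sharpFlatCharValue_rankZero :=
  lem59_of_lem55AllNcard_of_prop73_prop76 (lem55AllN_of_poitouTate hPTs hPT)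
    prop73_colemanFlat_surjective_holds prop76_colemanSharp_surjective_holds

/-- **Route `SignedLowerHalves`, support `SharpFlatCharValueRankZeroAllLevels` (item 19878) BY NAME ⟸ CASSELS
(Greenberg Prop. 4.13) + the ONE generic row `poitouTate_sha_tateDual ℚ`** (Milne ADT I Thm. 4.10 (a)). CONDITIONAL on
these named facts; does not close the item. [cite: Sprung2024, §5.2 (pp. 39–41)]
[cite: GreenbergLNM1716, §4 Prop. 4.13 / p. 122] [cite: MilneADT2006, Ch. I, Thm. 4.10 (a), Thm. 6.13] -/
theorem sharpFlatCharValueRankZeroAllLevels_of_cassels_of_poitouTate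
    (hC : Greenberg1999.casselsSurjectivity_H1Sigma ℚ) (hPT : poitouTate_sha_tateDual ℚ) :
    Summit.BirchSwinnertonDyer.BirchSwinnertonDyer.Theses.SignedLowerHalves.SharpFlatCharValueRankZeroAllLevels :=
  lem59AllN_of_cassels_of_poitouTate hC hPT

/-- **Route `SignedLowerHalves`, support `SharpFlatCharValueRankZeroAllLevels` (item 19878) BY NAME ⟸ the TWO
generic Poitou–Tate rows over `ℚ`** (Milne ADT I Thm. 4.10 for Selmer structures with Howard 2.1.11; Thm. 4.10 (a)).
CONDITIONAL on these named facts; does not close the item. [cite: Sprung2024, §5.2 (pp. 39–41)]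
[cite: MilneADT2006, Ch. I, Thm. 4.10, Thm. 6.13] -/
theorem sharpFlatCharValueRankZeroAllLevels_of_poitouTate (hPTs : poitouTate_selmerStructure_duality ℚ)
    (hPT : poitouTate_sha_tateDual ℚ) :
    Summit.BirchSwinnertonDyer.BirchSwinnertonDyer.Theses.SignedLowerHalves.SharpFlatCharValueRankZeroAllLevels :=
  lem59AllN_of_poitouTate hPTs hPT

end Summit.BirchSwinnertonDyer.BirchSwinnertonDyer.Theorems.SharpFlatCount

end
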